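import Literature.MathematicalPhysics.QuantumFieldTheory.Balaban1983to89.B5Hk163RDiv
import Literature.MathematicalPhysics.QuantumFieldTheory.Balaban1983to89.B5HierGaugeTorus
import Literature.MathematicalPhysics.QuantumFieldTheory.Balaban1983to89.B5Hk160Torus
import Literature.MathematicalPhysics.QuantumFieldTheory.Balaban1983to89.Beta.Ineq167Operator
import HarnessLib

/-!
# NE7LinOneStepGaugeCovariance — the regularity road, abelian flat model: THE CURVATURE OF THE LINEAR CONSTRAINED
# MINIMISER `H_kB` SEES THE DATUM ONLY THROUGH ITS GAUGE CLASS — `curl(H_k ∂μ) = 0` and `curl(H_k c) = 0`, hence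
# `curl H_k(B + ∂μ + c) = curl H_kB` for every coarse gauge function `μ` and every constant coarse field `c`

Cell `pub-balaban`, rung (B)+1 sub-cell t4, lineage `b2b-balaban-t4-ne7-p1`, generation 65 (CRUX PROVER NE7 #1, ruling e34b3e0c (2)); hunt
(h8) «REGULARITY ROAD», step (h8-ii) LIN-ONE-STEP (memo `t4/b2b-balaban-t4-ne7-p1-g64/HUNT-H8-REGULARITY-ROAD.md` §4).  File A of three.

WHY.  After gen 64 route 1's (A)-bill at curved data reads X-A4 ∧ ONE-STEP, ONE-STEP = [Balaban1985Variational] Thm 1 given an admissible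
competitor: the constrained minimiser's plaquette radius is `B₃ε₁η²`, B₃ depending on `d, L` ONLY — NOT `C₁B₃ε₁η²` with the competitor's
`C₁ = L³` ((13) p. 280).  Inside B11 the `C₁`-free bound is Sect. F: the estimate actually used in Sects. C–E is (46) `|∇HB| ≤ B₀(Lʲη)⁻²|B|`
(Thm 3.12 of B11's ref. [5] = [Balaban1985BackgroundPropagators], CMP 99) with the SUP OF THE DATUM on the right (its abelian flat image is gen 64's `NE7LinOneStepAbelianSup`), and the
improvement to the datum's CURVATURE comes from gauge covariance + locality + the linear growth of a cone (generalized axial) gauge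
((145) p. 301).  THIS FILE is the first of these three ingredients in the ABELIAN FLAT model (`U = 1`, torus `T_η → T₁`, `η = 1∕n`), for the
typed Landau minimiser `B5Hk163Torus.HkOp n M` of the cell `lit-balaban`:
* `Fs_HkOp_eq_zero_of_flat_competitor` — if the fibre `{Q_kA = B}` contains a FLAT field then `H_kB` is flat (the printed minimum property
  p. 29, kernel-proved by lit-balaban as `B5Hk163RDiv.HkOp_minimum_curvature`: `Σ|F[H_kB]|² ≤ Σ|F[A]|²`);
* **`Fs_HkOp_GradOp`** — `F_{μν}[H_k(∂¹μ)] = 0`: the coarse pure gauge `∂¹μ` is the average of the fine pure gauge `∂ⁿ(μ ∘ blockOf)`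
  ((1.20) `Q_k(∂ⁿλ) = ∂¹(Q′_kλ)`, lit-balaban's `B5HierGaugeTorus.QvOp_GradOp`, and `Q′_k(μ ∘ blockOf) = μ`, `B5Blocks16.QsOp_blockConst`);
* **`Fs_HkOp_constV`** — `F_{μν}[H_k c] = 0` for a constant coarse field `c` (the fine constant field averages to it, `B5Hk160Torus.QvOp_constV`);
* **`Fs_HkOp_gauge`** — `F_{μν}[H_k(B + ∂¹μ + c)](x) = F_{μν}[H_kB](x)` at every fine point: the map `B ↦ curl H_kB` kills exact and constant
  coarse fields, so it may be evaluated on ANY representative `B′ = B − ∂¹μ − c` — the freedom file C uses with the cone gauge of file B.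
HONEST FRAMING (page 1): ABELIAN, FLAT (`U = 1`), LINEAR bookkeeping over lit-balaban's kernel theorems; [folklore]; 0 def, 0 sorry.  NOT the
non-abelian ONE-STEP, NOT NE7; spine 0∕9; finite T⁴ rung (B)+1 — NOT infinite volume, NOT mass gap, NOT Clay.  Continuum YM on T⁴ ⇐ BetaPertH ∧
nine spine estimates (0/9 proved); BetaPertH ⇐ (D1) ∧ (D4) ∧ CAP+tail; G-an2-4 gates asym, D1 and NE2/3/4.
-/

set_option autoImplicit false

noncomputable section

open Finset Matrix

namespace Summit.QuantumFields.BalabanUV.T4Continuum.NE7LinOneStepGaugeCovariance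

open Literature.MathematicalPhysics.QuantumFieldTheory.Balaban1983to89
open B5Prop11Plancherel (Tor fine unitVec)
open B5Action121 (Fs Fs_apply GradOp)
open B5Block118 (QvOp QsOp)
open B5Blocks16 (blockOf QsOp_blockConst)
open B5Hk160Torus (constV QvOp_constV)
open B5Hk163Torus (HkOp)
open B5Hk163RDiv (HkOp_minimum_curvature)
open B5HierGaugeTorus (QvOp_GradOp)
open Beta.Ineq167Operator (Fs_add Fs_grad)

variable {d : ℕ}

/-! ## §1. Curvature bookkeeping on a torus `Tor N` with lattice factor `c` -/

section Curl

variable (N : Fin d → ℕ) [hN : ∀ μ, NeZero (N μ)]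

/-- `F_{μν}` is compatible with subtraction. [folklore] -/
theorem Fs_sub (c : ℂ) (A A' : Tor N × Fin d → ℂ) (μ ν : Fin d) (x : Tor N) :
    Fs N c (A - A') μ ν x = Fs N c A μ ν x - Fs N c A' μ ν x := by
  simp only [Fs_apply, Pi.sub_apply]
  ring

/-- the zero field is flat. [folklore] -/
theorem Fs_zero (c : ℂ) (μ ν : Fin d) (x : Tor N) : Fs N c (0 : Tor N × Fin d → ℂ) μ ν x = 0 := by
  simp only [Fs_apply, Pi.zero_apply]
  ring

/-- constant fields are flat. [folklore] -/
theorem Fs_constV (c : ℂ) (a : Fin d → ℂ) (μ ν : Fin d) (x : Tor N) : Fs N c (constV N a) μ ν x = 0 := by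
  simp only [Fs_apply, constV]
  ring

end Curl

/-! ## §2. `H_kB` is flat whenever the fibre `{Q_kA = B}` contains a flat field -/

section Minimiser

variable (n : ℕ) [NeZero n] (M : Fin d → ℕ) [hM : ∀ μ, NeZero (M μ)]

/-- a triple sum of non-negative reals bounded above by `0` vanishes termwise. [folklore] -/
theorem eq_zero_of_sum3_le_zero {α β γ : Type*} [Fintype α] [Fintype β] [Fintype γ] (g : α → β → γ → ℝ)
    (hg : ∀ a b c, 0 ≤ g a b c) (h : ∑ a, ∑ b, ∑ c, g a b c ≤ 0) (a : α) (b : β) (c : γ) : g a b c = 0 := by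
  have h1 : ∀ a', 0 ≤ ∑ b', ∑ c', g a' b' c' :=
    fun a' => Finset.sum_nonneg fun b' _ => Finset.sum_nonneg fun c' _ => hg a' b' c'
  have htot : ∑ a', ∑ b', ∑ c', g a' b' c' = 0 := le_antisymm h (Finset.sum_nonneg fun a' _ => h1 a')
  have ha : ∑ b', ∑ c', g a b' c' = 0 :=
    (Finset.sum_eq_zero_iff_of_nonneg fun a' _ => h1 a').1 htot a (Finset.mem_univ a)
  have hb : ∑ c', g a b c' = 0 :=
    (Finset.sum_eq_zero_iff_of_nonneg fun b' _ => Finset.sum_nonneg fun c' _ => hg a b' c').1 ha b (Finset.mem_univ b)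
  exact (Finset.sum_eq_zero_iff_of_nonneg fun c' _ => hg a b c').1 hb c (Finset.mem_univ c)

/-- **`H_kB` is flat if some field with average `B` is flat** — the printed minimum property «H_kB is a minimum of ½⟨∂A, ∂A⟩ on the
hyperplane {A : Q_kA = B, R∂*A = 0}» in curvature form (lit-balaban's `HkOp_minimum_curvature`: `Σ_{x,μ,ν}|F_{μν}[H_kB](x)|² ≤
Σ_{x,μ,ν}|F_{μν}[A](x)|²` for every `A` with `Q_kA = B`), applied to a flat competitor. [cite: Balaban1984PropagatorsI, p.29 (text)] [folklore] -/
theorem Fs_HkOp_eq_zero_of_flat_competitor (B : Tor M × Fin d → ℂ) (A : Tor (fine n M) × Fin d → ℂ)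
    (hA : QvOp n M *ᵥ A = B) (hflat : ∀ x μ ν, Fs (fine n M) (n : ℂ) A μ ν x = 0)
    (x : Tor (fine n M)) (μ ν : Fin d) :
    Fs (fine n M) (n : ℂ) (HkOp n M *ᵥ B) μ ν x = 0 := by
  have hmin := (HkOp_minimum_curvature n M B A hA).2
  have hzero : ∑ x', ∑ μ', ∑ ν', ‖Fs (fine n M) (n : ℂ) A μ' ν' x'‖ ^ 2 = 0 :=
    Finset.sum_eq_zero fun x' _ => Finset.sum_eq_zero fun μ' _ => Finset.sum_eq_zero fun ν' _ => by
      rw [hflat, norm_zero, zero_pow two_ne_zero]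
  rw [hzero] at hmin
  have hsq : ‖Fs (fine n M) (n : ℂ) (HkOp n M *ᵥ B) μ ν x‖ ^ 2 = 0 :=
    eq_zero_of_sum3_le_zero (fun x' μ' ν' => ‖Fs (fine n M) (n : ℂ) (HkOp n M *ᵥ B) μ' ν' x'‖ ^ 2)
      (fun _ _ _ => sq_nonneg _) hmin x μ ν
  exact norm_eq_zero.mp ((pow_eq_zero_iff two_ne_zero).mp hsq)

/-- **`curl(H_k ∂¹μ) = 0`**: the Landau minimiser of a coarse PURE GAUGE is flat — the fine pure gauge `∂ⁿ(μ ∘ blockOf)` lies in its fibre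
((1.20): `Q_k(∂ⁿλ) = ∂¹(Q′_kλ)`, `Q′_k(μ ∘ blockOf) = μ`) and is flat. [cite: Balaban1984PropagatorsI, (1.20) p.20, p.29 (text)] [folklore] -/
theorem Fs_HkOp_GradOp (m : Tor M → ℂ) (x : Tor (fine n M)) (μ ν : Fin d) :
    Fs (fine n M) (n : ℂ) (HkOp n M *ᵥ (GradOp M 1 *ᵥ m)) μ ν x = 0 := by
  refine Fs_HkOp_eq_zero_of_flat_competitor n M _ (GradOp (fine n M) (n : ℂ) *ᵥ fun x' => m (blockOf n M x')) ?_
    (fun x' μ' ν' => Fs_grad (fine n M) (n : ℂ) _ μ' ν' x') x μ ν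
  rw [QvOp_GradOp, QsOp_blockConst]

/-- **`curl(H_k c) = 0`** for a CONSTANT coarse field `c`: the fine constant field with the same components lies in its fibre
(`Q_k c = c`, lit-balaban's `QvOp_constV`) and is flat. [cite: Balaban1984PropagatorsI, p.27 before (1.58), p.29 (text)] [folklore] -/
theorem Fs_HkOp_constV (a : Fin d → ℂ) (x : Tor (fine n M)) (μ ν : Fin d) :
    Fs (fine n M) (n : ℂ) (HkOp n M *ᵥ constV M a) μ ν x = 0 :=
  Fs_HkOp_eq_zero_of_flat_competitor n M _ (constV (fine n M) a) (QvOp_constV n M a)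
    (fun x' μ' ν' => Fs_constV (fine n M) (n : ℂ) a μ' ν' x') x μ ν

/-- `curl H_k` is additive in the datum. [folklore] -/
theorem Fs_HkOp_add (B B' : Tor M × Fin d → ℂ) (x : Tor (fine n M)) (μ ν : Fin d) :
    Fs (fine n M) (n : ℂ) (HkOp n M *ᵥ (B + B')) μ ν x
      = Fs (fine n M) (n : ℂ) (HkOp n M *ᵥ B) μ ν x + Fs (fine n M) (n : ℂ) (HkOp n M *ᵥ B') μ ν x := by
  rw [Matrix.mulVec_add, Fs_add]

/-- `curl H_k` is compatible with subtraction in the datum. [folklore] -/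
theorem Fs_HkOp_sub (B B' : Tor M × Fin d → ℂ) (x : Tor (fine n M)) (μ ν : Fin d) :
    Fs (fine n M) (n : ℂ) (HkOp n M *ᵥ (B - B')) μ ν x
      = Fs (fine n M) (n : ℂ) (HkOp n M *ᵥ B) μ ν x - Fs (fine n M) (n : ℂ) (HkOp n M *ᵥ B') μ ν x := by
  rw [Matrix.mulVec_sub, Fs_sub]

/-- **GAUGE COVARIANCE OF `curl H_k`**: `F_{μν}[H_k(B + ∂¹m + c)](x) = F_{μν}[H_kB](x)` — exact and constant coarse fields are invisible
to the curvature of the Landau minimiser. [cite: Balaban1984PropagatorsI, (1.20) p.20, p.29 (text)] [folklore] -/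
theorem Fs_HkOp_gauge (B : Tor M × Fin d → ℂ) (m : Tor M → ℂ) (a : Fin d → ℂ) (x : Tor (fine n M)) (μ ν : Fin d) :
    Fs (fine n M) (n : ℂ) (HkOp n M *ᵥ (B + GradOp M 1 *ᵥ m + constV M a)) μ ν x
      = Fs (fine n M) (n : ℂ) (HkOp n M *ᵥ B) μ ν x := by
  rw [Fs_HkOp_add, Fs_HkOp_add, Fs_HkOp_GradOp, Fs_HkOp_constV, add_zero, add_zero]

/-- **THE REPRESENTATIVE FORM** used by file C: if `B − B′ = ∂¹m + c` then `curl H_kB = curl H_kB′` pointwise. [folklore] -/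
theorem Fs_HkOp_eq_of_sub_eq (B B' : Tor M × Fin d → ℂ) (m : Tor M → ℂ) (a : Fin d → ℂ)
    (h : B - B' = GradOp M 1 *ᵥ m + constV M a) (x : Tor (fine n M)) (μ ν : Fin d) :
    Fs (fine n M) (n : ℂ) (HkOp n M *ᵥ B) μ ν x = Fs (fine n M) (n : ℂ) (HkOp n M *ᵥ B') μ ν x := by
  have e : B = B' + GradOp M 1 *ᵥ m + constV M a := by rw [add_assoc, ← h]; abel
  rw [e, Fs_HkOp_gauge]

end Minimiser

end Summit.QuantumFields.BalabanUV.T4Continuum.NE7LinOneStepGaugeCovariance
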